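import Summits.BirchSwinnertonDyer.BirchSwinnertonDyer.Theorems.ByReductionTypeAtTwoSupersingularFlatClassKit
import HarnessLib

/-!
# Route `ByReductionTypeAtTwo` (rung K4), crux `SupersingularRankZeroAtTwo` (item stmt-BirchSwinnertonDyer-19097),
# UNIT-ANCHOR sub-row: the UNIT-ZONE ANCHORS (part C: ua67a1, ua75a1, ua99d1, ua115a1, ua179a1, ua187b1, ua189d1) — kernel-decided data of the small-conductor curves `A` that the
# unit-anchor transport road (`♭` objects) pairs with X5 good-supersingular `a₂ = ±2` classes (seat `bsd-2adic-ss-1x` GEN 4; census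
# UNIT-ANCHOR-CENSUS-v1, kit j287435; Tschirnhaus data kit j287765)

HONEST FRAMING (cell `bsd-2adic`, run/shared/lean/pub/bsd-2adic/, HUMAN RULINGS D-0036/D-0054/D-0074): THEOREMS ONLY — no
definition, no named fact, no instance, no `sorry`; closes nothing; nothing booked; BSD is NOT proved by any of this.
PARTITION (D-0054): X5@2 good-SUPERSINGULAR, `a₂ = ±2` UNIT-ANCHOR sub-row (45/549 rank-`0` classes) × `p = 2` —
types-the-object-of (the anchor side of the road `SSUnitAnchor.bsdp_two_of_unitAnchor_flat`); bears_on: K4-leaf 19097.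

Per anchor `A = M ⊗ ℚ` (Cremona's minimal model `M = [a₁,a₂,a₃,a₄,a₆]` of a rank-`0` curve of conductor `< 5·10⁵` whose
`2`-division field is that of a target class and which lies in the DOUBLE UNIT ZONE `2 ∤ ∏c_p · #Ш_an`, `#tors` odd — UNIT-ANCHOR-CENSUS-v1):
`Δ`, `c₄`, `b₂,b₄,b₆` (`decide`), `Δ ≠ 0`, global minimality (Silverman's criterion at the primes of `gcd(Δ, c₄)`, or `gcd = 1`),
`#Ã(𝔽₂) ∈ {1, 5}` hence good SUPERSINGULAR reduction at `2` with `a₂(A) = ±2` (the SAME `a₂` as the target classes). NOT kernel-decided (displayed as CERT hypotheses in the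
class files): `L(A,1) ≠ 0` (Cremona rank `0`), `2 ∤ ∏c_p(A)` (Tate's algorithm, Cremona), `2 ∤ #Ш(A)` (`#Ш_an` odd and, independently
of BSD, PARI `ellrank(A) = [0, 0, 0, []]`: 2-Selmer rank `0`, so `Ш(A)[2] = 0`). No CM statement is made or needed.

References: [CremonaAlgorithms1997] Table 1; [SilvermanAEC2009] III.1, V.2, VII.1 Rem. 1.1, VII.5 Prop. 5.1; UNIT-ANCHOR-CENSUS-v1.md
(run/shared/lean/pub/bsd-2adic/ss1x/gen4/); kit jobs j287435 (census), j287765 (Tschirnhaus).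
-/

set_option autoImplicit false
-- the Theorems namespace of this sub repeats the summit name by design (D-0017 nested layout)
set_option linter.dupNamespace false

noncomputable section

open scoped Classical

open WeierstrassCurve Literature.NumberTheory.EllipticCurves
  Literature.NumberTheory.EllipticCurves.Rank1Residual Literature.NumberTheory.EllipticCurves.Rank1Residual.Typed
  Summit.BirchSwinnertonDyer.Rank1Residual Summit.BirchSwinnertonDyer.Rank1Residual.Supersingular
  Summit.BirchSwinnertonDyer.Rank1Residual.X5 Summit.BirchSwinnertonDyer.Rank1Residual.X5.O1
  Summit.BirchSwinnertonDyer.Rank1Residual.X5.Instances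

namespace Summit.BirchSwinnertonDyer.BirchSwinnertonDyer.Theorems
namespace SSUnitAnchor

/-! ### The anchor `ua67a1` = Cremona `67a1` = `[0, 1, 1, -12, -21]` (`N = 67`, `a₂ = 2`; Cremona: rank `0`, `#tors = 1`, `∏c_p = 1`, `#Ш_an = 1` — double unit zone) -/

/-- `Δ = -67` for the anchor model `[0, 1, 1, -12, -21]`. [cite: CremonaAlgorithms1997, Table 1] -/
theorem ua67a1_Δ : (⟨0, 1, 1, -12, -21⟩ : WeierstrassCurve ℤ).Δ = -67 := by
  decide

/-- `c₄ = 592` for the anchor model `[0, 1, 1, -12, -21]`. [cite: CremonaAlgorithms1997, Table 1] -/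
theorem ua67a1_c₄ : (⟨0, 1, 1, -12, -21⟩ : WeierstrassCurve ℤ).c₄ = 592 := by
  decide

/-- `b₂, b₄, b₆` of the anchor model `[0, 1, 1, -12, -21]`. [cite: SilvermanAEC2009, III.1] -/
theorem ua67a1_b : (⟨0, 1, 1, -12, -21⟩ : WeierstrassCurve ℤ).b₂ = 4 ∧ (⟨0, 1, 1, -12, -21⟩ : WeierstrassCurve ℤ).b₄ = -24 ∧ (⟨0, 1, 1, -12, -21⟩ : WeierstrassCurve ℤ).b₆ = -83 := by
  decide

/-- The anchor `[0, 1, 1, -12, -21]` is an elliptic curve (`Δ ≠ 0`). [cite: CremonaAlgorithms1997, Table 1] -/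
theorem isElliptic_ua67a1 : ((⟨0, 1, 1, -12, -21⟩ : WeierstrassCurve ℤ).baseChange ℚ).IsElliptic := by
  rw [WeierstrassCurve.isElliptic_iff, baseChange_int_Δ, ua67a1_Δ]; norm_num

/-- The anchor model `[0, 1, 1, -12, -21]` is globally minimal: `gcd(Δ, c₄) = 1`.
[cite: SilvermanAEC2009, VII.1 Remark 1.1] -/
theorem isGloballyMinimal_ua67a1 : ((⟨0, 1, 1, -12, -21⟩ : WeierstrassCurve ℤ).baseChange ℚ).IsGloballyMinimal := by
  exact Instances.isGloballyMinimal_baseChange_int_of_gcd_eq_one (0) (1) (1) (-12) (-21)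
    (by decide)

/-- `#Ã(𝔽₂) = 1` for the anchor `[0, 1, 1, -12, -21]` (`a₁ = 0`, `a₃ = 1`), i.e. `a₂(A) = 2`. [cite: SilvermanAEC2009, V.2 and App. A Prop. 1.1 (c)] -/
theorem card_F2_ua67a1 :
    Nat.card ((⟨0, 1, 1, -12, -21⟩ : WeierstrassCurve ℤ).map (Int.castRingHom (ZMod 2))).toAffine.Point = 1 := by
  rw [natCard_point_F2_of_a₁_eq_zero_of_a₃_eq_one _ (by decide) (by decide)]
  decide

/-- **The anchor `[0, 1, 1, -12, -21]` is good SUPERSINGULAR at `2` with `a₂ = ±2`** (`2 ∤ Δ`, `#Ã(𝔽₂) = 1`).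
[cite: SilvermanAEC2009, VII.5 Prop. 5.1(a) and V.2] -/
theorem goodSS_two_ua67a1 [((⟨0, 1, 1, -12, -21⟩ : WeierstrassCurve ℤ).baseChange ℚ).IsGloballyMinimal] :
    ((⟨0, 1, 1, -12, -21⟩ : WeierstrassCurve ℤ).baseChange ℚ).HasGoodReductionAtPrime 2 ∧
      (((⟨0, 1, 1, -12, -21⟩ : WeierstrassCurve ℤ).baseChange ℚ).frobeniusTrace 2 = 2 ∨ ((⟨0, 1, 1, -12, -21⟩ : WeierstrassCurve ℤ).baseChange ℚ).frobeniusTrace 2 = -2) ∧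
      GoodSS ((⟨0, 1, 1, -12, -21⟩ : WeierstrassCurve ℤ).baseChange ℚ) 2 :=
  SSFlatRoad.goodSS_two_baseChange_int_of_card _ (by rw [ua67a1_Δ]; decide) card_F2_ua67a1 (by decide)

/-! ### The anchor `ua75a1` = Cremona `75a1` = `[0, -1, 1, -8, -7]` (`N = 75`, `a₂ = 2`; Cremona: rank `0`, `#tors = 1`, `∏c_p = 1`, `#Ш_an = 1` — double unit zone) -/

/-- `Δ = -1875` for the anchor model `[0, -1, 1, -8, -7]`. [cite: CremonaAlgorithms1997, Table 1] -/
theorem ua75a1_Δ : (⟨0, -1, 1, -8, -7⟩ : WeierstrassCurve ℤ).Δ = -1875 := by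
  decide

/-- `c₄ = 400` for the anchor model `[0, -1, 1, -8, -7]`. [cite: CremonaAlgorithms1997, Table 1] -/
theorem ua75a1_c₄ : (⟨0, -1, 1, -8, -7⟩ : WeierstrassCurve ℤ).c₄ = 400 := by
  decide

/-- `b₂, b₄, b₆` of the anchor model `[0, -1, 1, -8, -7]`. [cite: SilvermanAEC2009, III.1] -/
theorem ua75a1_b : (⟨0, -1, 1, -8, -7⟩ : WeierstrassCurve ℤ).b₂ = -4 ∧ (⟨0, -1, 1, -8, -7⟩ : WeierstrassCurve ℤ).b₄ = -16 ∧ (⟨0, -1, 1, -8, -7⟩ : WeierstrassCurve ℤ).b₆ = -27 := by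
  decide

/-- The anchor `[0, -1, 1, -8, -7]` is an elliptic curve (`Δ ≠ 0`). [cite: CremonaAlgorithms1997, Table 1] -/
theorem isElliptic_ua75a1 : ((⟨0, -1, 1, -8, -7⟩ : WeierstrassCurve ℤ).baseChange ℚ).IsElliptic := by
  rw [WeierstrassCurve.isElliptic_iff, baseChange_int_Δ, ua75a1_Δ]; norm_num

/-- The anchor model `[0, -1, 1, -8, -7]` is globally minimal: Silverman's criterion at the primes `{5}` of `gcd(Δ, c₄) = 25`.
[cite: SilvermanAEC2009, VII.1 Remark 1.1] -/
theorem isGloballyMinimal_ua75a1 : ((⟨0, -1, 1, -8, -7⟩ : WeierstrassCurve ℤ).baseChange ℚ).IsGloballyMinimal := by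
  rw [baseChange_int_eq]
  refine X11RankOneCertificates.isGloballyMinimal_of_int_criterion (0) (-1) (1) (-8) (-7)
    (int_criterion_of_primeFactors_gcd (by decide) ?_)
  have hg : (Int.gcd (X11RankOneCertificates.discOf [0, -1, 1, -8, -7])
      (X11RankOneCertificates.c4Of [0, -1, 1, -8, -7])).primeFactors = {5} := by
    rw [show Int.gcd (X11RankOneCertificates.discOf [0, -1, 1, -8, -7])
      (X11RankOneCertificates.c4Of [0, -1, 1, -8, -7]) = 25 by decide]
    simp [Nat.primeFactors]
  rw [hg]; decide

/-- `#Ã(𝔽₂) = 1` for the anchor `[0, -1, 1, -8, -7]` (`a₁ = 0`, `a₃ = 1`), i.e. `a₂(A) = 2`. [cite: SilvermanAEC2009, V.2 and App. A Prop. 1.1 (c)] -/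
theorem card_F2_ua75a1 :
    Nat.card ((⟨0, -1, 1, -8, -7⟩ : WeierstrassCurve ℤ).map (Int.castRingHom (ZMod 2))).toAffine.Point = 1 := by
  rw [natCard_point_F2_of_a₁_eq_zero_of_a₃_eq_one _ (by decide) (by decide)]
  decide

/-- **The anchor `[0, -1, 1, -8, -7]` is good SUPERSINGULAR at `2` with `a₂ = ±2`** (`2 ∤ Δ`, `#Ã(𝔽₂) = 1`).
[cite: SilvermanAEC2009, VII.5 Prop. 5.1(a) and V.2] -/
theorem goodSS_two_ua75a1 [((⟨0, -1, 1, -8, -7⟩ : WeierstrassCurve ℤ).baseChange ℚ).IsGloballyMinimal] :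
    ((⟨0, -1, 1, -8, -7⟩ : WeierstrassCurve ℤ).baseChange ℚ).HasGoodReductionAtPrime 2 ∧
      (((⟨0, -1, 1, -8, -7⟩ : WeierstrassCurve ℤ).baseChange ℚ).frobeniusTrace 2 = 2 ∨ ((⟨0, -1, 1, -8, -7⟩ : WeierstrassCurve ℤ).baseChange ℚ).frobeniusTrace 2 = -2) ∧
      GoodSS ((⟨0, -1, 1, -8, -7⟩ : WeierstrassCurve ℤ).baseChange ℚ) 2 :=
  SSFlatRoad.goodSS_two_baseChange_int_of_card _ (by rw [ua75a1_Δ]; decide) card_F2_ua75a1 (by decide)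

/-! ### The anchor `ua99d1` = Cremona `99d1` = `[0, 0, 1, -3, -5]` (`N = 99`, `a₂ = 2`; Cremona: rank `0`, `#tors = 1`, `∏c_p = 1`, `#Ш_an = 1` — double unit zone) -/

/-- `Δ = -8019` for the anchor model `[0, 0, 1, -3, -5]`. [cite: CremonaAlgorithms1997, Table 1] -/
theorem ua99d1_Δ : (⟨0, 0, 1, -3, -5⟩ : WeierstrassCurve ℤ).Δ = -8019 := by
  decide

/-- `c₄ = 144` for the anchor model `[0, 0, 1, -3, -5]`. [cite: CremonaAlgorithms1997, Table 1] -/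
theorem ua99d1_c₄ : (⟨0, 0, 1, -3, -5⟩ : WeierstrassCurve ℤ).c₄ = 144 := by
  decide

/-- `b₂, b₄, b₆` of the anchor model `[0, 0, 1, -3, -5]`. [cite: SilvermanAEC2009, III.1] -/
theorem ua99d1_b : (⟨0, 0, 1, -3, -5⟩ : WeierstrassCurve ℤ).b₂ = 0 ∧ (⟨0, 0, 1, -3, -5⟩ : WeierstrassCurve ℤ).b₄ = -6 ∧ (⟨0, 0, 1, -3, -5⟩ : WeierstrassCurve ℤ).b₆ = -19 := by
  decide

/-- The anchor `[0, 0, 1, -3, -5]` is an elliptic curve (`Δ ≠ 0`). [cite: CremonaAlgorithms1997, Table 1] -/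
theorem isElliptic_ua99d1 : ((⟨0, 0, 1, -3, -5⟩ : WeierstrassCurve ℤ).baseChange ℚ).IsElliptic := by
  rw [WeierstrassCurve.isElliptic_iff, baseChange_int_Δ, ua99d1_Δ]; norm_num

/-- The anchor model `[0, 0, 1, -3, -5]` is globally minimal: Silverman's criterion at the primes `{3}` of `gcd(Δ, c₄) = 9`.
[cite: SilvermanAEC2009, VII.1 Remark 1.1] -/
theorem isGloballyMinimal_ua99d1 : ((⟨0, 0, 1, -3, -5⟩ : WeierstrassCurve ℤ).baseChange ℚ).IsGloballyMinimal := by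
  rw [baseChange_int_eq]
  refine X11RankOneCertificates.isGloballyMinimal_of_int_criterion (0) (0) (1) (-3) (-5)
    (int_criterion_of_primeFactors_gcd (by decide) ?_)
  have hg : (Int.gcd (X11RankOneCertificates.discOf [0, 0, 1, -3, -5])
      (X11RankOneCertificates.c4Of [0, 0, 1, -3, -5])).primeFactors = {3} := by
    rw [show Int.gcd (X11RankOneCertificates.discOf [0, 0, 1, -3, -5])
      (X11RankOneCertificates.c4Of [0, 0, 1, -3, -5]) = 9 by decide]
    simp [Nat.primeFactors]
  rw [hg]; decide

/-- `#Ã(𝔽₂) = 1` for the anchor `[0, 0, 1, -3, -5]` (`a₁ = 0`, `a₃ = 1`), i.e. `a₂(A) = 2`. [cite: SilvermanAEC2009, V.2 and App. A Prop. 1.1 (c)] -/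
theorem card_F2_ua99d1 :
    Nat.card ((⟨0, 0, 1, -3, -5⟩ : WeierstrassCurve ℤ).map (Int.castRingHom (ZMod 2))).toAffine.Point = 1 := by
  rw [natCard_point_F2_of_a₁_eq_zero_of_a₃_eq_one _ (by decide) (by decide)]
  decide

/-- **The anchor `[0, 0, 1, -3, -5]` is good SUPERSINGULAR at `2` with `a₂ = ±2`** (`2 ∤ Δ`, `#Ã(𝔽₂) = 1`).
[cite: SilvermanAEC2009, VII.5 Prop. 5.1(a) and V.2] -/
theorem goodSS_two_ua99d1 [((⟨0, 0, 1, -3, -5⟩ : WeierstrassCurve ℤ).baseChange ℚ).IsGloballyMinimal] :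
    ((⟨0, 0, 1, -3, -5⟩ : WeierstrassCurve ℤ).baseChange ℚ).HasGoodReductionAtPrime 2 ∧
      (((⟨0, 0, 1, -3, -5⟩ : WeierstrassCurve ℤ).baseChange ℚ).frobeniusTrace 2 = 2 ∨ ((⟨0, 0, 1, -3, -5⟩ : WeierstrassCurve ℤ).baseChange ℚ).frobeniusTrace 2 = -2) ∧
      GoodSS ((⟨0, 0, 1, -3, -5⟩ : WeierstrassCurve ℤ).baseChange ℚ) 2 :=
  SSFlatRoad.goodSS_two_baseChange_int_of_card _ (by rw [ua99d1_Δ]; decide) card_F2_ua99d1 (by decide)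

/-! ### The anchor `ua115a1` = Cremona `115a1` = `[0, 0, 1, 7, -11]` (`N = 115`, `a₂ = 2`; Cremona: rank `0`, `#tors = 1`, `∏c_p = 1`, `#Ш_an = 1` — double unit zone) -/

/-- `Δ = -71875` for the anchor model `[0, 0, 1, 7, -11]`. [cite: CremonaAlgorithms1997, Table 1] -/
theorem ua115a1_Δ : (⟨0, 0, 1, 7, -11⟩ : WeierstrassCurve ℤ).Δ = -71875 := by
  decide

/-- `c₄ = -336` for the anchor model `[0, 0, 1, 7, -11]`. [cite: CremonaAlgorithms1997, Table 1] -/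
theorem ua115a1_c₄ : (⟨0, 0, 1, 7, -11⟩ : WeierstrassCurve ℤ).c₄ = -336 := by
  decide

/-- `b₂, b₄, b₆` of the anchor model `[0, 0, 1, 7, -11]`. [cite: SilvermanAEC2009, III.1] -/
theorem ua115a1_b : (⟨0, 0, 1, 7, -11⟩ : WeierstrassCurve ℤ).b₂ = 0 ∧ (⟨0, 0, 1, 7, -11⟩ : WeierstrassCurve ℤ).b₄ = 14 ∧ (⟨0, 0, 1, 7, -11⟩ : WeierstrassCurve ℤ).b₆ = -43 := by
  decide

/-- The anchor `[0, 0, 1, 7, -11]` is an elliptic curve (`Δ ≠ 0`). [cite: CremonaAlgorithms1997, Table 1] -/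
theorem isElliptic_ua115a1 : ((⟨0, 0, 1, 7, -11⟩ : WeierstrassCurve ℤ).baseChange ℚ).IsElliptic := by
  rw [WeierstrassCurve.isElliptic_iff, baseChange_int_Δ, ua115a1_Δ]; norm_num

/-- The anchor model `[0, 0, 1, 7, -11]` is globally minimal: `gcd(Δ, c₄) = 1`.
[cite: SilvermanAEC2009, VII.1 Remark 1.1] -/
theorem isGloballyMinimal_ua115a1 : ((⟨0, 0, 1, 7, -11⟩ : WeierstrassCurve ℤ).baseChange ℚ).IsGloballyMinimal := by
  exact Instances.isGloballyMinimal_baseChange_int_of_gcd_eq_one (0) (0) (1) (7) (-11)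
    (by decide)

/-- `#Ã(𝔽₂) = 1` for the anchor `[0, 0, 1, 7, -11]` (`a₁ = 0`, `a₃ = 1`), i.e. `a₂(A) = 2`. [cite: SilvermanAEC2009, V.2 and App. A Prop. 1.1 (c)] -/
theorem card_F2_ua115a1 :
    Nat.card ((⟨0, 0, 1, 7, -11⟩ : WeierstrassCurve ℤ).map (Int.castRingHom (ZMod 2))).toAffine.Point = 1 := by
  rw [natCard_point_F2_of_a₁_eq_zero_of_a₃_eq_one _ (by decide) (by decide)]
  decide

/-- **The anchor `[0, 0, 1, 7, -11]` is good SUPERSINGULAR at `2` with `a₂ = ±2`** (`2 ∤ Δ`, `#Ã(𝔽₂) = 1`).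
[cite: SilvermanAEC2009, VII.5 Prop. 5.1(a) and V.2] -/
theorem goodSS_two_ua115a1 [((⟨0, 0, 1, 7, -11⟩ : WeierstrassCurve ℤ).baseChange ℚ).IsGloballyMinimal] :
    ((⟨0, 0, 1, 7, -11⟩ : WeierstrassCurve ℤ).baseChange ℚ).HasGoodReductionAtPrime 2 ∧
      (((⟨0, 0, 1, 7, -11⟩ : WeierstrassCurve ℤ).baseChange ℚ).frobeniusTrace 2 = 2 ∨ ((⟨0, 0, 1, 7, -11⟩ : WeierstrassCurve ℤ).baseChange ℚ).frobeniusTrace 2 = -2) ∧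
      GoodSS ((⟨0, 0, 1, 7, -11⟩ : WeierstrassCurve ℤ).baseChange ℚ) 2 :=
  SSFlatRoad.goodSS_two_baseChange_int_of_card _ (by rw [ua115a1_Δ]; decide) card_F2_ua115a1 (by decide)

/-! ### The anchor `ua179a1` = Cremona `179a1` = `[0, 0, 1, -1, -1]` (`N = 179`, `a₂ = 2`; Cremona: rank `0`, `#tors = 1`, `∏c_p = 1`, `#Ш_an = 1` — double unit zone) -/

/-- `Δ = -179` for the anchor model `[0, 0, 1, -1, -1]`. [cite: CremonaAlgorithms1997, Table 1] -/
theorem ua179a1_Δ : (⟨0, 0, 1, -1, -1⟩ : WeierstrassCurve ℤ).Δ = -179 := by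
  decide

/-- `c₄ = 48` for the anchor model `[0, 0, 1, -1, -1]`. [cite: CremonaAlgorithms1997, Table 1] -/
theorem ua179a1_c₄ : (⟨0, 0, 1, -1, -1⟩ : WeierstrassCurve ℤ).c₄ = 48 := by
  decide

/-- `b₂, b₄, b₆` of the anchor model `[0, 0, 1, -1, -1]`. [cite: SilvermanAEC2009, III.1] -/
theorem ua179a1_b : (⟨0, 0, 1, -1, -1⟩ : WeierstrassCurve ℤ).b₂ = 0 ∧ (⟨0, 0, 1, -1, -1⟩ : WeierstrassCurve ℤ).b₄ = -2 ∧ (⟨0, 0, 1, -1, -1⟩ : WeierstrassCurve ℤ).b₆ = -3 := by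
  decide

/-- The anchor `[0, 0, 1, -1, -1]` is an elliptic curve (`Δ ≠ 0`). [cite: CremonaAlgorithms1997, Table 1] -/
theorem isElliptic_ua179a1 : ((⟨0, 0, 1, -1, -1⟩ : WeierstrassCurve ℤ).baseChange ℚ).IsElliptic := by
  rw [WeierstrassCurve.isElliptic_iff, baseChange_int_Δ, ua179a1_Δ]; norm_num

/-- The anchor model `[0, 0, 1, -1, -1]` is globally minimal: `gcd(Δ, c₄) = 1`.
[cite: SilvermanAEC2009, VII.1 Remark 1.1] -/
theorem isGloballyMinimal_ua179a1 : ((⟨0, 0, 1, -1, -1⟩ : WeierstrassCurve ℤ).baseChange ℚ).IsGloballyMinimal := by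
  exact Instances.isGloballyMinimal_baseChange_int_of_gcd_eq_one (0) (0) (1) (-1) (-1)
    (by decide)

/-- `#Ã(𝔽₂) = 1` for the anchor `[0, 0, 1, -1, -1]` (`a₁ = 0`, `a₃ = 1`), i.e. `a₂(A) = 2`. [cite: SilvermanAEC2009, V.2 and App. A Prop. 1.1 (c)] -/
theorem card_F2_ua179a1 :
    Nat.card ((⟨0, 0, 1, -1, -1⟩ : WeierstrassCurve ℤ).map (Int.castRingHom (ZMod 2))).toAffine.Point = 1 := by
  rw [natCard_point_F2_of_a₁_eq_zero_of_a₃_eq_one _ (by decide) (by decide)]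
  decide

/-- **The anchor `[0, 0, 1, -1, -1]` is good SUPERSINGULAR at `2` with `a₂ = ±2`** (`2 ∤ Δ`, `#Ã(𝔽₂) = 1`).
[cite: SilvermanAEC2009, VII.5 Prop. 5.1(a) and V.2] -/
theorem goodSS_two_ua179a1 [((⟨0, 0, 1, -1, -1⟩ : WeierstrassCurve ℤ).baseChange ℚ).IsGloballyMinimal] :
    ((⟨0, 0, 1, -1, -1⟩ : WeierstrassCurve ℤ).baseChange ℚ).HasGoodReductionAtPrime 2 ∧
      (((⟨0, 0, 1, -1, -1⟩ : WeierstrassCurve ℤ).baseChange ℚ).frobeniusTrace 2 = 2 ∨ ((⟨0, 0, 1, -1, -1⟩ : WeierstrassCurve ℤ).baseChange ℚ).frobeniusTrace 2 = -2) ∧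
      GoodSS ((⟨0, 0, 1, -1, -1⟩ : WeierstrassCurve ℤ).baseChange ℚ) 2 :=
  SSFlatRoad.goodSS_two_baseChange_int_of_card _ (by rw [ua179a1_Δ]; decide) card_F2_ua179a1 (by decide)

/-! ### The anchor `ua187b1` = Cremona `187b1` = `[0, 0, 1, 7, 1]` (`N = 187`, `a₂ = 2`; Cremona: rank `0`, `#tors = 1`, `∏c_p = 1`, `#Ш_an = 1` — double unit zone) -/

/-- `Δ = -22627` for the anchor model `[0, 0, 1, 7, 1]`. [cite: CremonaAlgorithms1997, Table 1] -/
theorem ua187b1_Δ : (⟨0, 0, 1, 7, 1⟩ : WeierstrassCurve ℤ).Δ = -22627 := by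
  decide

/-- `c₄ = -336` for the anchor model `[0, 0, 1, 7, 1]`. [cite: CremonaAlgorithms1997, Table 1] -/
theorem ua187b1_c₄ : (⟨0, 0, 1, 7, 1⟩ : WeierstrassCurve ℤ).c₄ = -336 := by
  decide

/-- `b₂, b₄, b₆` of the anchor model `[0, 0, 1, 7, 1]`. [cite: SilvermanAEC2009, III.1] -/
theorem ua187b1_b : (⟨0, 0, 1, 7, 1⟩ : WeierstrassCurve ℤ).b₂ = 0 ∧ (⟨0, 0, 1, 7, 1⟩ : WeierstrassCurve ℤ).b₄ = 14 ∧ (⟨0, 0, 1, 7, 1⟩ : WeierstrassCurve ℤ).b₆ = 5 := by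
  decide

/-- The anchor `[0, 0, 1, 7, 1]` is an elliptic curve (`Δ ≠ 0`). [cite: CremonaAlgorithms1997, Table 1] -/
theorem isElliptic_ua187b1 : ((⟨0, 0, 1, 7, 1⟩ : WeierstrassCurve ℤ).baseChange ℚ).IsElliptic := by
  rw [WeierstrassCurve.isElliptic_iff, baseChange_int_Δ, ua187b1_Δ]; norm_num

/-- The anchor model `[0, 0, 1, 7, 1]` is globally minimal: `gcd(Δ, c₄) = 1`.
[cite: SilvermanAEC2009, VII.1 Remark 1.1] -/
theorem isGloballyMinimal_ua187b1 : ((⟨0, 0, 1, 7, 1⟩ : WeierstrassCurve ℤ).baseChange ℚ).IsGloballyMinimal := by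
  exact Instances.isGloballyMinimal_baseChange_int_of_gcd_eq_one (0) (0) (1) (7) (1)
    (by decide)

/-- `#Ã(𝔽₂) = 1` for the anchor `[0, 0, 1, 7, 1]` (`a₁ = 0`, `a₃ = 1`), i.e. `a₂(A) = 2`. [cite: SilvermanAEC2009, V.2 and App. A Prop. 1.1 (c)] -/
theorem card_F2_ua187b1 :
    Nat.card ((⟨0, 0, 1, 7, 1⟩ : WeierstrassCurve ℤ).map (Int.castRingHom (ZMod 2))).toAffine.Point = 1 := by
  rw [natCard_point_F2_of_a₁_eq_zero_of_a₃_eq_one _ (by decide) (by decide)]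
  decide

/-- **The anchor `[0, 0, 1, 7, 1]` is good SUPERSINGULAR at `2` with `a₂ = ±2`** (`2 ∤ Δ`, `#Ã(𝔽₂) = 1`).
[cite: SilvermanAEC2009, VII.5 Prop. 5.1(a) and V.2] -/
theorem goodSS_two_ua187b1 [((⟨0, 0, 1, 7, 1⟩ : WeierstrassCurve ℤ).baseChange ℚ).IsGloballyMinimal] :
    ((⟨0, 0, 1, 7, 1⟩ : WeierstrassCurve ℤ).baseChange ℚ).HasGoodReductionAtPrime 2 ∧
      (((⟨0, 0, 1, 7, 1⟩ : WeierstrassCurve ℤ).baseChange ℚ).frobeniusTrace 2 = 2 ∨ ((⟨0, 0, 1, 7, 1⟩ : WeierstrassCurve ℤ).baseChange ℚ).frobeniusTrace 2 = -2) ∧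
      GoodSS ((⟨0, 0, 1, 7, 1⟩ : WeierstrassCurve ℤ).baseChange ℚ) 2 :=
  SSFlatRoad.goodSS_two_baseChange_int_of_card _ (by rw [ua187b1_Δ]; decide) card_F2_ua187b1 (by decide)

/-! ### The anchor `ua189d1` = Cremona `189d1` = `[0, 0, 1, -27, -7]` (`N = 189`, `a₂ = 2`; Cremona: rank `0`, `#tors = 1`, `∏c_p = 1`, `#Ш_an = 1` — double unit zone) -/

/-- `Δ = 1240029` for the anchor model `[0, 0, 1, -27, -7]`. [cite: CremonaAlgorithms1997, Table 1] -/
theorem ua189d1_Δ : (⟨0, 0, 1, -27, -7⟩ : WeierstrassCurve ℤ).Δ = 1240029 := by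
  decide

/-- `c₄ = 1296` for the anchor model `[0, 0, 1, -27, -7]`. [cite: CremonaAlgorithms1997, Table 1] -/
theorem ua189d1_c₄ : (⟨0, 0, 1, -27, -7⟩ : WeierstrassCurve ℤ).c₄ = 1296 := by
  decide

/-- `b₂, b₄, b₆` of the anchor model `[0, 0, 1, -27, -7]`. [cite: SilvermanAEC2009, III.1] -/
theorem ua189d1_b : (⟨0, 0, 1, -27, -7⟩ : WeierstrassCurve ℤ).b₂ = 0 ∧ (⟨0, 0, 1, -27, -7⟩ : WeierstrassCurve ℤ).b₄ = -54 ∧ (⟨0, 0, 1, -27, -7⟩ : WeierstrassCurve ℤ).b₆ = -27 := by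
  decide

/-- The anchor `[0, 0, 1, -27, -7]` is an elliptic curve (`Δ ≠ 0`). [cite: CremonaAlgorithms1997, Table 1] -/
theorem isElliptic_ua189d1 : ((⟨0, 0, 1, -27, -7⟩ : WeierstrassCurve ℤ).baseChange ℚ).IsElliptic := by
  rw [WeierstrassCurve.isElliptic_iff, baseChange_int_Δ, ua189d1_Δ]; norm_num

/-- The anchor model `[0, 0, 1, -27, -7]` is globally minimal: Silverman's criterion at the primes `{3}` of `gcd(Δ, c₄) = 81`.
[cite: SilvermanAEC2009, VII.1 Remark 1.1] -/
theorem isGloballyMinimal_ua189d1 : ((⟨0, 0, 1, -27, -7⟩ : WeierstrassCurve ℤ).baseChange ℚ).IsGloballyMinimal := by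
  rw [baseChange_int_eq]
  refine X11RankOneCertificates.isGloballyMinimal_of_int_criterion (0) (0) (1) (-27) (-7)
    (int_criterion_of_primeFactors_gcd (by decide) ?_)
  have hg : (Int.gcd (X11RankOneCertificates.discOf [0, 0, 1, -27, -7])
      (X11RankOneCertificates.c4Of [0, 0, 1, -27, -7])).primeFactors = {3} := by
    rw [show Int.gcd (X11RankOneCertificates.discOf [0, 0, 1, -27, -7])
      (X11RankOneCertificates.c4Of [0, 0, 1, -27, -7]) = 81 by decide]
    simp [Nat.primeFactors]
  rw [hg]; decide

/-- `#Ã(𝔽₂) = 1` for the anchor `[0, 0, 1, -27, -7]` (`a₁ = 0`, `a₃ = 1`), i.e. `a₂(A) = 2`. [cite: SilvermanAEC2009, V.2 and App. A Prop. 1.1 (c)] -/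
theorem card_F2_ua189d1 :
    Nat.card ((⟨0, 0, 1, -27, -7⟩ : WeierstrassCurve ℤ).map (Int.castRingHom (ZMod 2))).toAffine.Point = 1 := by
  rw [natCard_point_F2_of_a₁_eq_zero_of_a₃_eq_one _ (by decide) (by decide)]
  decide

/-- **The anchor `[0, 0, 1, -27, -7]` is good SUPERSINGULAR at `2` with `a₂ = ±2`** (`2 ∤ Δ`, `#Ã(𝔽₂) = 1`).
[cite: SilvermanAEC2009, VII.5 Prop. 5.1(a) and V.2] -/
theorem goodSS_two_ua189d1 [((⟨0, 0, 1, -27, -7⟩ : WeierstrassCurve ℤ).baseChange ℚ).IsGloballyMinimal] :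
    ((⟨0, 0, 1, -27, -7⟩ : WeierstrassCurve ℤ).baseChange ℚ).HasGoodReductionAtPrime 2 ∧
      (((⟨0, 0, 1, -27, -7⟩ : WeierstrassCurve ℤ).baseChange ℚ).frobeniusTrace 2 = 2 ∨ ((⟨0, 0, 1, -27, -7⟩ : WeierstrassCurve ℤ).baseChange ℚ).frobeniusTrace 2 = -2) ∧
      GoodSS ((⟨0, 0, 1, -27, -7⟩ : WeierstrassCurve ℤ).baseChange ℚ) 2 :=
  SSFlatRoad.goodSS_two_baseChange_int_of_card _ (by rw [ua189d1_Δ]; decide) card_F2_ua189d1 (by decide)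

end SSUnitAnchor
end Summit.BirchSwinnertonDyer.BirchSwinnertonDyer.Theorems

end
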